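import Literature.AlgebraicGeometry.Frobenioids.UnitWiseFrobeniusZetaExists
import Literature.AnabelianGeometry.EtaleTheta.Discharge.Sec4Prop42SubRefinement
import Literature.AnabelianGeometry.EtaleTheta.Discharge.Sec4Prop42SubBaseLiftUpToUnit
import Literature.AnabelianGeometry.EtaleTheta.Discharge.Sec4Prop42SubUnitRoots

/-!
# [EtTh] Prop 4.2 (iii), sub-node L01a `Prop42Sub.RootOverCovering` (ERRATUM E2) AT THE CANONICAL MODEL,
# REDUCED to ONE base-level law; Prop 4.2 (iii) ∧ (iv) there modulo base-level laws only

Mochizuki, *The étale theta function and its Frobenioid-theoretic manifestations*, Publ. RIMS **45** (2009),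
§4, Prop. 4.2 (iii), proof PDF p. 89 L77–80 (printed p. 315) [cite: MochizukiEtTh2009, Prop 4.2 p.89]:
«by the definition of "log-meromorphic" [cf. Definition 3.1, (ii)], it follows immediately that over some
tempered covering of `X^log` … `f` admits an `N`-th root» — with Def. 3.1 (ii) read through ERRATUM E2
([IUTchI] Rmk. 3.2.4 (i)/(iv), approach (A): *tempered*-meromorphic functions).  abc-iut cell, layer L2,
plan/L2/SUBDAG-EtTh-Prop42.md §B row L01a (seat abc-iut-w4-d044, gen 3; L2-lead RULINGS #13 (R101));
DAG node `EtTh:Prop4.2(iii)`.  PROOF-ONLY companion (0 `def`s) of `Prop42Sub.lean` (abc-iut-w5-d134),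
`BiKummerOfModelCanonical.lean` (abc-iut-L2-t9) and this lineage's `Sec4Prop42SubRefinement.lean` /
`Sec4Prop42SubUnitRoots.lean`; abc-iut-w5-d134's `Prop42Sub.prop42_iii_mkOfModelCanonical_of_inSkeleton`
(`Sec4Prop42SubBaseLiftUpToUnit.lean`) is CONSUMED BY NAME.  Nothing landed is edited or restated.

## What is proved

At the canonical model instance `mkOfModelCanonical X tf …` of the §4 setting (birational vocabulary =
[FrdI] Thm. 5.2 (ii): `O^×(A^birat) = B(A_D)^×`, transport `pullFracModel φ = B(Base φ)`), the covering
step L01a `RootOverCovering` — until now carried by every Prop 4.2 (iii) closer as a §4-STRUCTURED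
hypothesis (it speaks of pull-back morphisms, Frobenius-trivial / Galois / `μ_N`-saturated OBJECTS OF `C`
and birational units) — follows from ONE law stated on the base data `(D, B)` alone,

* `hR` — the **tempered-meromorphic root law** (ERRATUM E2 at the level of the rational-function monoid):
  for every `N`, every Galois `A ∈ Ob(D)` and every `f ∈ B(A)`, there are a Galois `A' ∈ Ob(D)`, an arrow
  `b : A' → A` of `D` and `g ∈ B(A')` with `g^N = B(b)(f)`,

together with the refinement law `hE` of [FrdII] Rmk. 2.2.1 / Def. 2.2 (ii)(a)(b) already isolated by this
lineage (plan/GAP-LEDGER.md row G-w4d044-2; here only its `μ_N`-saturation / Galois / pull-back clauses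
are used).  ALL Frobenioid-level bookkeeping of the printed sentence is PROVED in the model Frobenioid:
the pull-back morphism `(1, b, 0, 1) : (A'_D, b^*α) → A_⊙` of [FrdI] Thm. 5.2 (i) over a base arrow
(`exists_isPullback_over_baseHom`), Frobenius-triviality of its source, composition of pull-backs and the
transport of the root along the refinement (`rootOverCovering_mkOfModelCanonical_of_laws`).

The skeleton normalisation of abc-iut-w5-d134's L01′ (`SaturatedRootCoverInSkeleton`: the covering object
IS `A_⊙` whenever its base is isomorphic to `A_⊙^bs`; «we may assume `C` is a skeleton», [FrdI] p. 102) is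
then obtained for free from [FrdI] Thm. 5.1 (iii) BASE-TRIVIALITY of Frobenius-trivial objects
(`exists_iso_baseMap_eq_of_isFrobeniusTrivial`: over any base isomorphism two principal objects of the
model Frobenioid are isomorphic in `C`) by transporting the saturation data along that `C`-isomorphism
(`isMuSaturated_of_iso`, `isSaturated_Aodot_of_iso`) — so
`saturatedRootCoverInSkeleton_mkOfModelCanonical_of_laws (hΦd) (hR) (hE) (hS)`, and, by abc-iut-w5-d134's
composition, **`Prop42Sub.prop42_iii_mkOfModelCanonical_of_laws (hΦd) (hDSpull) (hR) (hE) (hS)`**;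
with this lineage's Prop 4.2 (iv) closer, **`prop42_iii_iv_mkOfModelCanonical_of_laws`** adds `hL`.

NODE READING (no side taken on anything downstream; [EtTh] is a refereed prerequisite paper):
[EtTh] Prop. 4.2 (iii) ∧ (iv) AS TYPED at `mkOfModelCanonical` ⇐ { `Φ` divisorial, the [FrdI] Prop. 4.1
(iii) coprimality-pull-back law `hDSpull`, `hR` (E2 root law on `(D, B)`), `hE` (G-w4d044-2), `hS`
(Def. 4.1 (ii) outer naturality of `Π^tp_X ↠ Aut_D(−)` — a THEOREM at the temperoid model,
`BTemp.galoisSurjOf_natural`), `hL` (G-w4d044-1) } — every hypothesis is now a law on the base data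
`(D, Φ, B, IG, gS, NH)`; no §4-structured binder remains.  `hR` is recorded as GAP-LEDGER row G-w4d044-3
(a binder owed by the merge of abc-iut-L2-t10's `LogDivisorModel.temperedMero` (TemperedCoverings.lean)
with the rational-function functor `B` of the tempered Frobenioid; not a new `def … : Prop`, D-0067 (5)).
-/

noncomputable section

namespace Literature.AnabelianGeometry.EtaleTheta

open CategoryTheory Opposite Literature.AlgebraicGeometry.Frobenioids

universe u₀ v₀ u v w

variable {K : Type u₀} [Field K]

namespace BiKummerSetting

variable {X : SemiGraphs.TemperedArithmeticGroup.{u₀} K} {D₀ : Type u₀} [Category.{v₀} D₀]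
  {V : FrdIMonoidStub.{w}} {T : RealifiedDivisorMonoids (D₀ := D₀) V} {D : Type u} [Category.{v} D]
  {VD : FrdICatStub.{u, v, w} D} (S : BiKummerSetting X T D VD)

/-! ### Model bookkeeping ([FrdI] Thm. 5.2): pull-backs over base arrows, base-triviality, transport -/

/-- **The pull-back morphism over a base arrow** ([FrdI] Def. 1.3 (i)(b) for the model Frobenioid of
Thm. 5.2 (i)): over `b : A'_D → Base(A)` the arrow `(1, b, 0, 1) : (A'_D, Φ(b)(α)) → A = (A_D, α)` is a
pull-back morphism, and an `N`-th root `g ∈ B(A'_D)` of `B(b)(f)` is an `N`-th root of `f|` in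
`O^×((A'_D, Φ(b)α)^birat) = B(A'_D)^×` for the transport `pullFracModel` (`B` group-like, `Φ` divisorial).
[cite: MochizukiFrdI2008, Thm. 5.2(i) p.100] -/
theorem exists_isPullback_over_baseHom (hΦd : Objectwise (fun M _ => IsDivisorial M) S.tf.divisorMonoid)
    (hBg : Objectwise (fun M _ => IsGroupLike M) S.tf.ratFnFunctor) (A : S.C) {A' : D} (b : A' ⟶ A.base)
    {N : ℕ} {f : S.tf.biratUnitsModel A} {g : S.tf.ratFnFunctor.obj (op A')}
    (hg : g ^ N = pull S.tf.ratFnFunctor b (f : S.tf.ratFnFunctor.obj (op A.base))) :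
    ∃ (W : S.C) (δ : W ⟶ A) (g' : S.tf.biratUnitsModel W), W.base = A' ∧ S.IsPullback δ ∧
      g' ^ N = S.tf.pullFracModel δ f := by
  let W : S.C := ⟨A', pullGp S.tf.divisorMonoid b A.cls⟩
  let δ : W ⟶ A := ModelFrobenioid.mkHom W A 1 b 1 1 (by
    rw [PNat.one_coe, pow_one, map_one, mul_one, map_one, mul_one])
  obtain ⟨gu, hgu⟩ := (hBg A').isUnit g
  refine ⟨W, δ, gu, rfl, ModelFrobenioid.isPullbackMorphism_of hΦd hBg rfl rfl, ?_⟩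
  apply Units.ext
  rw [Units.val_pow_eq_pow_val, hgu, TemperedFrobenioid.coe_pullFracModel_apply, hg]
  rfl

/-- Transport of `N`-th roots along composites for `pullFracModel` (`B(Base(ψ ≫ φ)) = B(Base ψ) ∘ B(Base φ)`,
[FrdI] Prop. 1.11 (iv)): an `N`-th root `g` of `B(Base φ) f` gives the `N`-th root `B(Base ψ) g` of
`B(Base(ψ ≫ φ)) f`. [cite: MochizukiEtTh2009, Prop 4.2 p.88] -/
theorem pullFracModel_pow_eq_of_comp {A B E : S.C} (ψ : A ⟶ B) (φ : B ⟶ E) {N : ℕ}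
    {f : S.tf.biratUnitsModel E} {g : S.tf.biratUnitsModel B} (hg : g ^ N = S.tf.pullFracModel φ f) :
    S.tf.pullFracModel ψ g ^ N = S.tf.pullFracModel (ψ ≫ φ) f := by
  rw [← map_pow, hg]
  apply Units.ext
  rw [TemperedFrobenioid.coe_pullFracModel_apply, TemperedFrobenioid.coe_pullFracModel_apply,
    TemperedFrobenioid.coe_pullFracModel_apply, ModelFrobenioid.baseMap_comp, op_comp, Functor.map_comp]
  rfl

/-- **[FrdI] Thm. 5.1 (iii) base-triviality for the model Frobenioid** («the isomorphism class of a
Frobenius-trivial object of `C` is completely determined by the isomorphism class of its projection to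
`D`»): two Frobenius-trivial (= principal, `(A_D, Div_B(a))`) objects are isomorphic in `C` over ANY given
isomorphism of their bases — by the arrow `(1, e, 0, a · (e^* b)⁻¹)` (`B` group-like).
[cite: MochizukiFrdI2008, Thm. 5.1 (iii) p.97] -/
theorem exists_iso_baseMap_eq_of_isFrobeniusTrivial
    (hBg : Objectwise (fun M _ => IsGroupLike M) S.tf.ratFnFunctor) {A B : S.C}
    (hA : S.IsFrobeniusTrivial A) (hB : S.IsFrobeniusTrivial B) (e : A.base ≅ B.base) :
    ∃ σ : A ≅ B, ModelFrobenioid.baseMap σ.hom = e.hom := by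
  obtain ⟨a, ha⟩ := ModelFrobenioid.exists_cls_eq_divB_of_isFrobeniusTrivial A hA
  obtain ⟨b, hb⟩ := ModelFrobenioid.exists_cls_eq_divB_of_isFrobeniusTrivial B hB
  obtain ⟨w, hw⟩ := (hBg A.base).isUnit (pull S.tf.ratFnFunctor e.hom b)
  let lift : A ⟶ B := ModelFrobenioid.mkHom A B 1 e.hom 1 (a * ↑w⁻¹) (by
    rw [PNat.one_coe, pow_one, map_one, mul_one, ha, hb, ModelFrobenioid.pullGp_divB_pull, ← hw, ← map_mul,
      mul_left_comm, Units.mul_inv, mul_one])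
  haveI : IsIso (ModelFrobenioid.baseMap lift) := by
    change IsIso e.hom
    infer_instance
  haveI : IsIso lift := ModelFrobenioid.isIso_of hBg lift rfl rfl
  exact ⟨asIso lift, rfl⟩

/-- `μ_N`-saturation ([FrdII] Def. 2.1 (i)) is invariant under isomorphism in `C`: conjugation by
`σ : A ≅ B` carries `O^×(A)` onto `O^×(B)` (base-identity linear automorphisms) and `μ_N(A)` onto `μ_N(B)`,
preserving orders. [cite: MochizukiEtTh2009, Def 4.1 p.87] -/
theorem isMuSaturated_of_iso {A B : S.C} (σ : A ≅ B) {N : ℕ+} (h : S.IsMuSaturated A N) :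
    S.IsMuSaturated B N := by
  have hmu : ∀ {A B : S.C} (σ : A ≅ B) (τ : Aut A), τ ∈ S.tf.mu A N → σ.conjAut τ ∈ S.tf.mu B N := by
    intro A B σ τ hτ
    exact ⟨(PreFrobenioid.conjUnits (F := S.F) σ ⟨τ, hτ.1⟩).2,
      by rw [← map_pow, hτ.2, map_one]⟩
  have hback : ∀ τ' : Aut B, σ.conjAut (σ.symm.conjAut τ') = τ' := by
    intro τ'
    apply Iso.ext
    rw [Iso.conjAut_hom, Iso.conj_apply, Iso.conjAut_hom, Iso.conj_apply, Iso.symm_inv, Iso.symm_hom,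
      Category.assoc, Category.assoc, σ.inv_hom_id_assoc, σ.inv_hom_id, Category.comp_id]
  obtain ⟨τ, hτ, hord, hgen⟩ := h
  refine ⟨σ.conjAut τ, hmu σ τ hτ, ?_, fun τ' hτ' => ?_⟩
  · rw [← hord]
    exact orderOf_injective σ.conjAut.toMonoidHom σ.conjAut.injective τ
  · obtain ⟨k, hk⟩ := Subgroup.mem_zpowers_iff.1 (hgen _ (hmu σ.symm τ' hτ'))
    exact Subgroup.mem_zpowers_iff.2 ⟨k, by rw [← map_zpow, hk, hback]⟩

end BiKummerSetting

namespace BiKummerSetting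

/-! ### At the canonical model `mkOfModelCanonical` -/

section Canonical

variable (X : SemiGraphs.TemperedArithmeticGroup.{u₀} K) {D₀ : Type u₀}
  [Category.{v₀} D₀] {V : FrdIMonoidStub.{w}} {T : RealifiedDivisorMonoids (D₀ := D₀) V}
  {D : Type u} [Category.{v} D] {VD : FrdICatStub.{u, v, w} D}
  (tf : TemperedFrobenioid T D VD) (hZ : tf.monoidType = MonoidType.Z)
  (hP : ∀ A : Dᵒᵖ, IsPerfect (tf.Φ.carrier A)) (IG : D → Prop) (gS : ∀ A : D, IG A → (X.Pi →* Aut A))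
  (gSs : ∀ (A : D) (h : IG A), Function.Surjective (gS A h))
  (NH : Subgroup (Field.absoluteGaloisGroup K) → tf.category → ℕ+ → Prop) (A₀ : tf.category)
  (hA₀ : PreFrobenioid.IsFrobeniusTrivial tf.toElem A₀) (hA₀' : IG A₀.base)

/-- **Transport of `(N, H_⊙, f|)`-saturation (Def. 4.1 (iii)) to `A_⊙` along a `C`-isomorphism
`σ : A' ⥲ A_⊙`** (canonical model): if `A'` is `(N, H_⊙, B(Base φ) f)`-saturated for `φ : A' → A_⊙`, then
`A_⊙` is `(N, H_⊙, B(Base(σ⁻¹ ≫ φ)) f)`-saturated — `A_⊙` is `H_⊙`-ample (a Frobenius-trivial Galois object of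
the model Frobenioid: every base automorphism lifts, [FrdI] Thm. 5.1 (iii)), `H_{A_⊙}` fixes every pull-back
of `f` to `A_⊙` (naturality law `hS` of Def. 4.1 (ii) — `H_⊙ = Ker(Π^tp_X ↠ Aut(A_⊙^bs))` is normal), the
linked `(N, H_⊙^{bs-fld})`-saturated Frobenius-trivial object of (a) is re-linked through the pre-step
`s₁ ≫ σ`, and the root of (b) is transported by `B(Base σ⁻¹)`. [cite: MochizukiEtTh2009, Def 4.1 p.87] -/
theorem isSaturated_Aodot_mkOfModelCanonical_of_iso
    (hS : ∀ ⦃A B : D⦄ (hA : IG A) (hB : IG B) (b : B ⟶ A),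
      ∃ c : X.Pi, ∀ g : X.Pi, (gS B hB g).hom ≫ b = b ≫ (gS A hA (c * g * c⁻¹)).hom)
    {A' : tf.category} {N : ℕ+} {φ : A' ⟶ A₀} {f : tf.biratUnitsModel A₀}
    (hsat : (mkOfModelCanonical X tf hZ hP IG gS gSs NH A₀ hA₀ hA₀').IsSaturated A' N (tf.pullFracModel φ f))
    (σ : A' ≅ A₀) :
    (mkOfModelCanonical X tf hZ hP IG gS gSs NH A₀ hA₀ hA₀').IsSaturated A₀ N
      (tf.pullFracModel (σ.inv ≫ φ) f) := by
  have hBg := tf.isGroupLike_ratFnFunctor T.isUnit_BΛ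
  have hamp : (mkOfModelCanonical X tf hZ hP IG gS gSs NH A₀ hA₀ hA₀').IsAmple A₀ :=
    (mkOfModelCanonical X tf hZ hP IG gS gSs NH A₀ hA₀ hA₀').isAmple_of_isFrobeniusTrivial hBg hA₀ hA₀'
  refine ⟨hamp, ?_, ?_, ?_⟩
  · -- `H_{A_⊙}` fixes `B(Base(σ⁻¹ ≫ φ)) f`: `Base τ ≫ Base(σ⁻¹ ≫ φ) = Base(σ⁻¹ ≫ φ)` for `τ ∈ H_{A_⊙}`
    intro τ hτ
    have hb : ModelFrobenioid.baseMap τ.inv ≫ ModelFrobenioid.baseMap (σ.inv ≫ φ) =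
        ModelFrobenioid.baseMap (σ.inv ≫ φ) :=
      (mkOfModelCanonical X tf hZ hP IG gS gSs NH A₀ hA₀ hA₀').baseMap_comp_eq_of_mem_HA hS hamp.isGalois
        (inv_mem hτ) (ModelFrobenioid.baseMap (σ.inv ≫ φ))
    apply Units.ext
    change ((tf.biratAutModel A₀ τ (tf.pullFracModel (σ.inv ≫ φ) f) : tf.biratUnitsModel A₀) :
        tf.ratFnFunctor.obj (op A₀.base)) =
      ((tf.pullFracModel (σ.inv ≫ φ) f : tf.biratUnitsModel A₀) : tf.ratFnFunctor.obj (op A₀.base))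
    rw [TemperedFrobenioid.coe_biratAutModel_apply, TemperedFrobenioid.coe_pullFracModel_apply,
      ← CategoryTheory.comp_apply, ← Functor.map_comp, ← op_comp, hb]
  · -- (a): re-link the `(N, H_⊙^{bs-fld})`-saturated Frobenius-trivial object through `s₁ ≫ σ`
    obtain ⟨A₁, A₂, s₁, s₂, hs₁, hs₂, hft₂, hNH⟩ := hsat.cond_a
    exact ⟨A₁, A₂, s₁ ≫ σ.hom, s₂, ModelFrobenioid.isPreStep_comp_of_isIso hs₁ σ.hom, hs₂, hft₂, hNH⟩
  · -- (b): the root transported along `σ⁻¹`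
    obtain ⟨g, hg⟩ := hsat.cond_b
    exact ⟨tf.pullFracModel σ.inv g,
      (mkOfModelCanonical X tf hZ hP IG gS gSs NH A₀ hA₀ hA₀').pullFracModel_pow_eq_of_comp σ.inv φ hg⟩

/-- **L01a `RootOverCovering` AT THE CANONICAL MODEL from the base-level tempered-meromorphic root law `hR`
(ERRATUM E2) and the refinement law `hE` ([FrdII] Rmk. 2.2.1 / Def. 2.2 (ii)(a)(b); only its pull-back /
Galois / `μ_N`-saturation clauses are used here)** — `Φ` divisorial: the root of `f ∈ O^×(A_⊙^birat) =
B(A_⊙^bs)^×` over the Galois base covering `b : A'_D → A_⊙^bs` supplied by `hR` lives on the pull-back object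
`(A'_D, b^*α_⊙)` (a Frobenius-trivial Galois object of `C` with its pull-back morphism to `A_⊙`), and is
transported to the `μ_N`-saturated Galois refinement supplied by `hE` along a further pull-back morphism.
[cite: MochizukiEtTh2009, Prop 4.2 p.89] -/
theorem Prop42Sub.rootOverCovering_mkOfModelCanonical_of_laws
    (hΦd : Objectwise (fun M _ => IsDivisorial M) tf.divisorMonoid)
    (hR : ∀ (N : ℕ+) (A : D), IG A → ∀ f : tf.ratFnFunctor.obj (op A),
      ∃ (A' : D) (_ : IG A') (b : A' ⟶ A) (g : tf.ratFnFunctor.obj (op A')),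
        g ^ (N : ℕ) = pull tf.ratFnFunctor b f)
    (hE : ∀ (N : ℕ+) (A' : tf.category), PreFrobenioid.IsFrobeniusTrivial tf.toElem A' → IG A'.base →
      ∃ (A'' : tf.category) (ψ : A'' ⟶ A'), PreFrobenioid.IsPullbackMorphism tf.toElem ψ ∧ IG A''.base ∧
        tf.IsMuSaturated A'' N ∧ NH (mkOfModelCanonical X tf hZ hP IG gS gSs NH A₀ hA₀ hA₀').HodotBsFld A'' N) :
    Prop42Sub.RootOverCovering (mkOfModelCanonical X tf hZ hP IG gS gSs NH A₀ hA₀ hA₀')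
      (fun {_ _} φ x => tf.pullFracModel φ x) := by
  have hBg := tf.isGroupLike_ratFnFunctor T.isUnit_BΛ
  intro N f
  obtain ⟨A', hA', b, g, hg⟩ :=
    hR N A₀.base hA₀' ((show tf.biratUnitsModel A₀ from f) : tf.ratFnFunctor.obj (op A₀.base))
  obtain ⟨W, δ, g', hWb, hδ, hg'⟩ :=
    (mkOfModelCanonical X tf hZ hP IG gS gSs NH A₀ hA₀ hA₀').exists_isPullback_over_baseHom hΦd hBg A₀ b hg
  have hWft : PreFrobenioid.IsFrobeniusTrivial tf.toElem W :=
    (mkOfModelCanonical X tf hZ hP IG gS gSs NH A₀ hA₀ hA₀').isFrobeniusTrivial_of_isPullback hΦd hBg hδ hA₀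
  have hWG : IG W.base := by
    rw [hWb]
    exact hA'
  obtain ⟨A'', ψ, hψ, hG'', hμ, -⟩ := hE N W hWft hWG
  refine ⟨A'', ψ ≫ δ, ?_, ?_, hG'', hμ, tf.pullFracModel ψ g', ?_⟩
  · exact (mkOfModelCanonical X tf hZ hP IG gS gSs NH A₀ hA₀ hA₀').isPullback_comp hΦd hBg hψ hδ
  · exact (mkOfModelCanonical X tf hZ hP IG gS gSs NH A₀ hA₀ hA₀').isFrobeniusTrivial_of_isPullback hΦd
      hBg hψ hWft
  · exact (mkOfModelCanonical X tf hZ hP IG gS gSs NH A₀ hA₀ hA₀').pullFracModel_pow_eq_of_comp ψ δ hg'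

/-- **L01′ `SaturatedRootCoverInSkeleton` AT THE CANONICAL MODEL from the laws `hR`, `hE`, `hS`** (`Φ`
divisorial): L01a (`rootOverCovering_mkOfModelCanonical_of_laws`) followed by L01b (this lineage's
`saturatedRefinement_mkOfModelCanonical_of_laws`) gives the saturated root-carrying covering `φ : A_N → A_⊙`
(`Prop42Sub.saturatedRootCover_of`); the skeleton clause («we may assume `C` is a skeleton», [FrdI] p. 102)
is then free: if `A_N^bs ≅ A_⊙^bs`, replace `(A_N, φ)` by `(A_⊙, σ⁻¹ ≫ φ)` along the `C`-isomorphism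
`σ : A_N ⥲ A_⊙` of [FrdI] Thm. 5.1 (iii) base-triviality (`exists_iso_baseMap_eq_of_isFrobeniusTrivial`),
transporting `μ_N`- and `(N, H_⊙, f|)`-saturation (`isMuSaturated_of_iso`,
`isSaturated_Aodot_mkOfModelCanonical_of_iso`). [cite: MochizukiEtTh2009, Prop 4.2 p.89] -/
theorem Prop42Sub.saturatedRootCoverInSkeleton_mkOfModelCanonical_of_laws
    (hΦd : Objectwise (fun M _ => IsDivisorial M) tf.divisorMonoid)
    (hR : ∀ (N : ℕ+) (A : D), IG A → ∀ f : tf.ratFnFunctor.obj (op A),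
      ∃ (A' : D) (_ : IG A') (b : A' ⟶ A) (g : tf.ratFnFunctor.obj (op A')),
        g ^ (N : ℕ) = pull tf.ratFnFunctor b f)
    (hE : ∀ (N : ℕ+) (A' : tf.category), PreFrobenioid.IsFrobeniusTrivial tf.toElem A' → IG A'.base →
      ∃ (A'' : tf.category) (ψ : A'' ⟶ A'), PreFrobenioid.IsPullbackMorphism tf.toElem ψ ∧ IG A''.base ∧
        tf.IsMuSaturated A'' N ∧ NH (mkOfModelCanonical X tf hZ hP IG gS gSs NH A₀ hA₀ hA₀').HodotBsFld A'' N)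
    (hS : ∀ ⦃A B : D⦄ (hA : IG A) (hB : IG B) (b : B ⟶ A),
      ∃ c : X.Pi, ∀ g : X.Pi, (gS B hB g).hom ≫ b = b ≫ (gS A hA (c * g * c⁻¹)).hom) :
    Prop42Sub.SaturatedRootCoverInSkeleton (mkOfModelCanonical X tf hZ hP IG gS gSs NH A₀ hA₀ hA₀')
      (fun {_ _} φ x => tf.pullFracModel φ x) := by
  have hBg := tf.isGroupLike_ratFnFunctor T.isUnit_BΛ
  have h₁ : Prop42Sub.SaturatedRootCover (mkOfModelCanonical X tf hZ hP IG gS gSs NH A₀ hA₀ hA₀')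
      (fun {_ _} φ x => tf.pullFracModel φ x) :=
    Prop42Sub.saturatedRootCover_of (mkOfModelCanonical X tf hZ hP IG gS gSs NH A₀ hA₀ hA₀')
      (Prop42Sub.rootOverCovering_mkOfModelCanonical_of_laws X tf hZ hP IG gS gSs NH A₀ hA₀ hA₀' hΦd hR hE)
      (saturatedRefinement_mkOfModelCanonical_of_laws X tf hZ hP IG gS gSs NH A₀ hA₀ hA₀' hΦd hE hS)
  intro N f
  obtain ⟨A', φ, hφ, hft, hgal, hmu, hsat⟩ := h₁ N f
  by_cases hne : Nonempty (A'.base ≅ A₀.base)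
  · -- degenerate corner `A_N^bs ≅ A_⊙^bs`: normalise to `A_⊙` itself along the `C`-isomorphism of base-triviality
    obtain ⟨e⟩ := hne
    obtain ⟨σ, -⟩ := (mkOfModelCanonical X tf hZ hP IG gS gSs NH A₀ hA₀ hA₀').exists_iso_baseMap_eq_of_isFrobeniusTrivial
      hBg hft hA₀ e
    refine ⟨A₀, σ.inv ≫ φ, fun _ => rfl, ?_, hA₀, hA₀', ?_, ?_⟩
    · exact PreFrobenioid.IsPullbackMorphism.comp _ (PreFrobenioid.isPullbackMorphism_of_isIso _ σ.inv) hφ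
    · exact (mkOfModelCanonical X tf hZ hP IG gS gSs NH A₀ hA₀ hA₀').isMuSaturated_of_iso σ hmu
    · exact isSaturated_Aodot_mkOfModelCanonical_of_iso X tf hZ hP IG gS gSs NH A₀ hA₀ hA₀' hS hsat σ
  · exact ⟨A', φ, fun h => (hne h).elim, hφ, hft, hgal, hmu, hsat⟩

/-- **[EtTh] Prop. 4.2 (iii) AS TYPED at the canonical model, modulo base-level laws only**: `Φ`
divisorial, the [FrdI] Prop. 4.1 (iii) coprimality-pull-back law `hDSpull`, the E2 root law `hR`, the
[FrdII] Rmk. 2.2.1 refinement law `hE` (G-w4d044-2) and the Def. 4.1 (ii) naturality law `hS` — by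
abc-iut-w5-d134's `Prop42Sub.prop42_iii_mkOfModelCanonical_of_inSkeleton` applied to
`saturatedRootCoverInSkeleton_mkOfModelCanonical_of_laws`. [cite: MochizukiEtTh2009, Prop 4.2 p.88] -/
theorem Prop42Sub.prop42_iii_mkOfModelCanonical_of_laws
    (hΦd : Objectwise (fun M _ => IsDivisorial M) tf.divisorMonoid)
    (hDSpull : ∀ {A A' : D} (e : A' ⟶ A) {a b : tf.Φ.carrier (op A)},
      (∀ x : tf.Φ.carrier (op A), x ∣ a → x ∣ b → x = 1) →
        ∀ y : tf.Φ.carrier (op A'), y ∣ pull tf.divisorMonoid e a → y ∣ pull tf.divisorMonoid e b → y = 1)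
    (hR : ∀ (N : ℕ+) (A : D), IG A → ∀ f : tf.ratFnFunctor.obj (op A),
      ∃ (A' : D) (_ : IG A') (b : A' ⟶ A) (g : tf.ratFnFunctor.obj (op A')),
        g ^ (N : ℕ) = pull tf.ratFnFunctor b f)
    (hE : ∀ (N : ℕ+) (A' : tf.category), PreFrobenioid.IsFrobeniusTrivial tf.toElem A' → IG A'.base →
      ∃ (A'' : tf.category) (ψ : A'' ⟶ A'), PreFrobenioid.IsPullbackMorphism tf.toElem ψ ∧ IG A''.base ∧
        tf.IsMuSaturated A'' N ∧ NH (mkOfModelCanonical X tf hZ hP IG gS gSs NH A₀ hA₀ hA₀').HodotBsFld A'' N)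
    (hS : ∀ ⦃A B : D⦄ (hA : IG A) (hB : IG B) (b : B ⟶ A),
      ∃ c : X.Pi, ∀ g : X.Pi, (gS B hB g).hom ≫ b = b ≫ (gS A hA (c * g * c⁻¹)).hom) :
    (mkOfModelCanonical X tf hZ hP IG gS gSs NH A₀ hA₀ hA₀').Prop42_iii (fun {_ _} φ x => tf.pullFracModel φ x) :=
  Prop42Sub.prop42_iii_mkOfModelCanonical_of_inSkeleton X tf hZ hP IG gS gSs NH A₀ hA₀ hA₀' hΦd hDSpull
    (Prop42Sub.saturatedRootCoverInSkeleton_mkOfModelCanonical_of_laws X tf hZ hP IG gS gSs NH A₀ hA₀ hA₀'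
      hΦd hR hE hS)

/-- **[EtTh] Prop. 4.2 (iii) ∧ (iv) AS TYPED at the canonical model, modulo base-level laws only** — the
JOINT FLOOR of DAG node `EtTh:Prop4.2(iii)`/`(iv)`: `Φ` divisorial, `hDSpull` ([FrdI] Prop. 4.1 (iii)),
`hR` (ERRATUM E2 root law), `hE` (G-w4d044-2), `hS` (Def. 4.1 (ii)), `hL` (G-w4d044-1, the roots-of-constants
law of [FrdII] Rmk. 2.2.1 + [EtTh] Prop. 3.4 (ii)); (iv) by this lineage's
`prop42_iv_mkOfModelCanonical_of_constantRoots`. [cite: MochizukiEtTh2009, Prop 4.2 p.88] -/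
theorem Prop42Sub.prop42_iii_iv_mkOfModelCanonical_of_laws
    (hΦd : Objectwise (fun M _ => IsDivisorial M) tf.divisorMonoid)
    (hDSpull : ∀ {A A' : D} (e : A' ⟶ A) {a b : tf.Φ.carrier (op A)},
      (∀ x : tf.Φ.carrier (op A), x ∣ a → x ∣ b → x = 1) →
        ∀ y : tf.Φ.carrier (op A'), y ∣ pull tf.divisorMonoid e a → y ∣ pull tf.divisorMonoid e b → y = 1)
    (hR : ∀ (N : ℕ+) (A : D), IG A → ∀ f : tf.ratFnFunctor.obj (op A),
      ∃ (A' : D) (_ : IG A') (b : A' ⟶ A) (g : tf.ratFnFunctor.obj (op A')),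
        g ^ (N : ℕ) = pull tf.ratFnFunctor b f)
    (hE : ∀ (N : ℕ+) (A' : tf.category), PreFrobenioid.IsFrobeniusTrivial tf.toElem A' → IG A'.base →
      ∃ (A'' : tf.category) (ψ : A'' ⟶ A'), PreFrobenioid.IsPullbackMorphism tf.toElem ψ ∧ IG A''.base ∧
        tf.IsMuSaturated A'' N ∧ NH (mkOfModelCanonical X tf hZ hP IG gS gSs NH A₀ hA₀ hA₀').HodotBsFld A'' N)
    (hS : ∀ ⦃A B : D⦄ (hA : IG A) (hB : IG B) (b : B ⟶ A),
      ∃ c : X.Pi, ∀ g : X.Pi, (gS B hB g).hom ≫ b = b ≫ (gS A hA (c * g * c⁻¹)).hom)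
    (hL : ∀ (A'' : tf.category) (N : ℕ+) (g : A''.base ⟶ A₀.base)
      (ξ : tf.ratFnFunctor.obj (op A₀.base)),
      PreFrobenioid.IsFrobeniusTrivial tf.toElem A'' →
      NH (mkOfModelCanonical X tf hZ hP IG gS gSs NH A₀ hA₀ hA₀').HodotBsFld A'' N →
      divB tf.divisorMonoid tf.ratFnFunctor tf.divBNatTrans (op A₀.base) ξ = 1 →
        ∃ ζ : tf.ratFnFunctor.obj (op A''.base), ζ ^ (N : ℕ) = pull tf.ratFnFunctor g ξ) :
    (mkOfModelCanonical X tf hZ hP IG gS gSs NH A₀ hA₀ hA₀').Prop42_iii (fun {_ _} φ x => tf.pullFracModel φ x) ∧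
      (mkOfModelCanonical X tf hZ hP IG gS gSs NH A₀ hA₀ hA₀').Prop42_iv (fun φ x => tf.pullFracModel φ x) :=
  ⟨Prop42Sub.prop42_iii_mkOfModelCanonical_of_laws X tf hZ hP IG gS gSs NH A₀ hA₀ hA₀' hΦd hDSpull hR hE hS,
    prop42_iv_mkOfModelCanonical_of_constantRoots X tf hZ hP IG gS gSs NH A₀ hA₀ hA₀' hΦd hL⟩

end Canonical

end BiKummerSetting

end Literature.AnabelianGeometry.EtaleTheta

end
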